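import Summits.AtomisticToContinuum.Crystallization.Theorems.HullExactificationCascadeHcpLandscapeGapExactBarlowPricing
import Summits.AtomisticToContinuum.Crystallization.Theorems.HullExactificationCascadeHcpLandscapeGapStubJensenShift
import Summits.AtomisticToContinuum.Crystallization.Theorems.HullExactificationCascadeHcpLandscapeGapStubRegistryMajorisationHeights
import Summits.AtomisticToContinuum.Crystallization.Theorems.HullExactificationCascadeHcpLandscapeGapStubFreeBlockBounds

/-!
# Crux `HcpLandscapeGap` (stmt-AtomisticToContinuum-12087), line `registered` (birth): stub RC
# `stub_relaxedColumn` — the RELAXED COLUMN INEQUALITY (lead glue of skeleton v11)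

The registered stub RC of the relaxed-Barlow cut of stub T (`Cruxes/HcpLandscapeGap/Lines/birth.lean`,
v10/v11, lead c6).  At B's box minimiser `(a, h)`: there are `g > 0`, `C` such that for every in-layer scale
`a' ∈ [47/50, 1]`, Hägg word `s`, height profile `H` with all spacings in `[39a'/50, 17a'/20]` and layers
`M₁ ≤ M₂`, the column sum of the FULL site energies (in the layer form of RS) is at least

  `(M₂ − M₁ + 1)·2e_LJ(hcp a h) + g·Σ_{m=M₁}^{M₂} ([s (m+1) = s m] + (a' − a)² + (H (m+1) − H m − h)²) − C`.

Glue over the three LANDED worker stubs of wave 2 and the landed modulus: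

* RC-W2 `stub_registryMajorisationHeights` (p164934): per site, the actual registry pattern dominates the
  alternating (hcp) pattern at the same heights plus `c₀` per adjacent cubic bond;
* RC-W3 `stub_freeBlockBounds` (p165713): (a) the column of alternating layer series is `≥ 2F_n(Δ) − C_F`,
  `F_n` the free alternating block energy of `LayeredHull.stub_convexity`, `Δ` the column's increments;
  (b) `(n+1)(2·hcpE a' h' − Φ₀(a')) ≤ 2F_n(h'·1)` for `h'` in the band;
* RC-W1 `stub_jensenShift` (p165320): `F_n(mean·1) + κ Σ_i (Δ i − mean)² ≤ F_n(Δ) + C_J`;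
* `modulus_at_boxMinimiser` (p158625): `(a, h)` lies in the HcpDefectCounting box and
  `e_LJ(hcp a h) + c((a'−a)² + (h'−h)²) ≤ e_LJ(hcp a' h')` on that box; `hcpE = e_LJ(hcp · ·)` by
  `hcpEnergySeries_of_eq`.

Bookkeeping: `Σ_{l<n} (Δ l − h)² = Σ_{l<n} (Δ l − mean)² + n (mean − h)²`; the last bond of the column and the
one-layer column are absorbed in `C`; `g = min (min c₀ (2c)) (2κ)`.  All `[folklore]`.
-/

noncomputable section

namespace Summit.AtomisticToContinuum.Crystallization.Theorems.HcpLandscapeGapBirth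

open Literature.MathematicalPhysics.StatisticalMechanics
open Summit.AtomisticToContinuum.Crystallization.Theorems

namespace RelaxedColumn

/-- The mean of finitely many numbers in an interval lies in the interval. [folklore] -/
theorem mean_mem {n : ℕ} (hn : 1 ≤ n) {Δ : ℕ → ℝ} {lo hi : ℝ}
    (h : ∀ i : ℕ, i < n → lo ≤ Δ i ∧ Δ i ≤ hi) :
    lo ≤ (∑ i ∈ Finset.range n, Δ i) / n ∧ (∑ i ∈ Finset.range n, Δ i) / n ≤ hi := by
  have hn0 : (0 : ℝ) < n := by exact_mod_cast hn
  have h1 : ∑ _i ∈ Finset.range n, lo ≤ ∑ i ∈ Finset.range n, Δ i :=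
    Finset.sum_le_sum fun i hi' => (h i (Finset.mem_range.1 hi')).1
  have h2 : ∑ i ∈ Finset.range n, Δ i ≤ ∑ _i ∈ Finset.range n, hi :=
    Finset.sum_le_sum fun i hi' => (h i (Finset.mem_range.1 hi')).2
  rw [Finset.sum_const, Finset.card_range, nsmul_eq_mul] at h1 h2
  constructor
  · rw [le_div_iff₀ hn0]; linarith
  · rw [div_le_iff₀ hn0]; linarith

/-- Deviations from a point split through the mean:
`Σ_{i<n} (Δ i − t)² = Σ_{i<n} (Δ i − mean)² + n (mean − t)²`. [folklore] -/
theorem sum_sq_sub_eq {n : ℕ} (hn : 1 ≤ n) (Δ : ℕ → ℝ) (t : ℝ) :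
    ∑ i ∈ Finset.range n, (Δ i - t) ^ 2 =
      ∑ i ∈ Finset.range n, (Δ i - (∑ i' ∈ Finset.range n, Δ i') / n) ^ 2 +
        n * ((∑ i' ∈ Finset.range n, Δ i') / n - t) ^ 2 := by
  have hn0 : (n : ℝ) ≠ 0 := by exact_mod_cast (show n ≠ 0 by omega)
  set μ : ℝ := (∑ i' ∈ Finset.range n, Δ i') / n with hμ
  have hsum : ∑ i ∈ Finset.range n, Δ i = n * μ := by
    rw [hμ]; field_simp
  have hpt : ∀ i, (Δ i - t) ^ 2 = (Δ i - μ) ^ 2 + 2 * (μ - t) * (Δ i - μ) + (μ - t) ^ 2 := by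
    intro i; ring
  simp_rw [hpt, Finset.sum_add_distrib, ← Finset.mul_sum, Finset.sum_sub_distrib, Finset.sum_const,
    Finset.card_range, nsmul_eq_mul, hsum]
  ring

end RelaxedColumn

open RelaxedColumn in
/-- **Stub RC — the RELAXED COLUMN INEQUALITY** (registered stub of skeleton v10/v11, lead glue over
RC-W1/W2/W3 and the box modulus; see the module docstring). [folklore] -/
theorem stub_relaxedColumn : ∀ (a h : ℝ) (ha : a ≠ 0) (hh : h ≠ 0), (9 / 10 < a ∧ a < 1 ∧ |h - a * Real.sqrt (2 / 3)| ≤ a / 100) → (∀ a' h' : ℝ, ∀ ha' : a' ≠ 0, ∀ hh' : h' ≠ 0, (9 / 10 < a' ∧ a' < 1 ∧ |h' - a' * Real.sqrt (2 / 3)| ≤ a' / 100) → (Literature.MathematicalPhysics.StatisticalMechanics.hcpPeriodicConfiguration ha hh).energyPerParticle Literature.MathematicalPhysics.StatisticalMechanics.lennardJones ≤ (Literature.MathematicalPhysics.StatisticalMechanics.hcpPeriodicConfiguration ha' hh').energyPerParticle Literature.MathematicalPhysics.StatisticalMechanics.lennardJones) → ∃ g : ℝ, 0 < g ∧ ∃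 C : ℝ, ∀ a' : ℝ, 47 / 50 ≤ a' → a' ≤ 1 → ∀ s : ℤ → ℤ, Literature.MathematicalPhysics.StatisticalMechanics.IsHaggSeq s → ∀ H : ℤ → ℝ, (∀ k : ℤ, 39 / 50 * a' ≤ H (k + 1) - H k ∧ H (k + 1) - H k ≤ 17 / 20 * a') → ∀ M₁ M₂ : ℤ, M₁ ≤ M₂ → ((M₂ - M₁ + 1 : ℤ) : ℝ) * (2 * (Literature.MathematicalPhysics.StatisticalMechanics.hcpPeriodicConfiguration ha hh).energyPerParticle Literature.MathematicalPhysics.StatisticalMechanics.lennardJones) + g * (∑ m ∈ Finset.Icc M₁ M₂, ((if s (m + 1) = s m then (1 : ℝ) else 0) + (a' - a) ^ 2 + (H (m + 1) - H m - h) ^ 2)) ≤ (∑ m ∈ Finset.Icc M₁ M₂, (Literature.MathematicalPhysics.StatisticalMechanics.inLayerInteraction Literature.MathematicalPhysics.StatisticalMechanics.lennardJones a' + ∑' k : ℤ, (if k = m then (0 : ℝ) else Literature.MathematicalPhysics.StatisticalMechanics.layerInteraction Literature.MathematicalPhysics.StatisticalMechanics.lennardJones a' (H k - H m) (Literature.MathematicalPhysics.StatisticalMechanics.haggLabel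 s k - Literature.MathematicalPhysics.StatisticalMechanics.haggLabel s m) 1))) + C := by
  intro a h ha hh hbox hmin
  obtain ⟨⟨ha1, ha2, hh1, hh2⟩, c, hc, hmod⟩ := modulus_at_boxMinimiser a h ha hh hbox hmin
  obtain ⟨c₀, hc₀, hW2⟩ := stub_registryMajorisationHeights
  obtain ⟨κ, hκ, CJ, hW1⟩ := stub_jensenShift
  obtain ⟨⟨CF, hW3a⟩, hW3b⟩ := stub_freeBlockBounds
  set g : ℝ := min (min c₀ (2 * c)) (2 * κ) with hg
  have hg0 : 0 < g := by rw [hg]; positivity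
  have hgc₀ : g ≤ c₀ := (min_le_left _ _).trans (min_le_left _ _)
  have hgc : g ≤ 2 * c := (min_le_left _ _).trans (min_le_right _ _)
  have hgκ : g ≤ 2 * κ := min_le_right _ _
  refine ⟨g, hg0, 2 * max CJ 0 + CF + 3 * g, ?_⟩
  intro a' ha' ha'1 s hs H hH M₁ M₂ hM
  obtain ⟨n, rfl⟩ : ∃ n : ℕ, M₂ = M₁ + n := ⟨(M₂ - M₁).toNat, by omega⟩
  have ha'0 : 0 < a' := by linarith
  -- opaque abbreviations with pointwise equations
  obtain ⟨estar, hestar⟩ : ∃ e : ℝ, e = (hcpPeriodicConfiguration ha hh).energyPerParticle lennardJones :=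
    ⟨_, rfl⟩
  obtain ⟨Tact, hTact⟩ : ∃ T : ℤ → ℝ, ∀ m : ℤ, T m = ∑' k : ℤ, (if k = m then (0 : ℝ) else
      layerInteraction lennardJones a' (H k - H m) (haggLabel s k - haggLabel s m) 1) := ⟨_, fun _ => rfl⟩
  obtain ⟨Talt, hTalt⟩ : ∃ T : ℤ → ℝ, ∀ m : ℤ, T m = ∑' k : ℤ, (if k = m then (0 : ℝ) else
      layerInteraction lennardJones a' (H k - H m) (if Even (k - m) then 0 else 1) 1) := ⟨_, fun _ => rfl⟩
  obtain ⟨fault, hfault⟩ : ∃ f : ℤ → ℝ, ∀ m : ℤ, f m = if s (m + 1) = s m then (1 : ℝ) else 0 :=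
    ⟨_, fun _ => rfl⟩
  obtain ⟨Δ, hΔ⟩ : ∃ D : ℕ → ℝ, ∀ l : ℕ, D l = H (M₁ + l + 1) - H (M₁ + l) := ⟨_, fun _ => rfl⟩
  have hΔband : ∀ l : ℕ, l < n → 39 / 50 * a' ≤ Δ l ∧ Δ l ≤ 17 / 20 * a' := fun l _ => by
    rw [hΔ]
    have := hH (M₁ + l)
    exact ⟨by linarith [this.1], by linarith [this.2]⟩
  -- hcpE = e_LJ(hcp) and the modulus floor, for every `h'` in the band
  have hfloor : ∀ h' : ℝ, 39 / 50 * a' ≤ h' → h' ≤ 17 / 20 * a' →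
      estar + c * ((a' - a) ^ 2 + (h' - h) ^ 2) ≤
        PalmUnimodularRigidity.LayeredLawsSelectHcp.hcpE a' h' := by
    intro h' hh'1 hh'2
    have hh'0 : 0 < h' := by linarith
    have e1 : PalmUnimodularRigidity.LayeredLawsSelectHcp.hcpE a' h' =
        (hcpPeriodicConfiguration ha'0.ne' hh'0.ne').energyPerParticle lennardJones :=
      ((ExcessDecayLiouvilleCoarseGrains.hcpEnergySeries_of_eq a' h' ha'0.ne' hh'0.ne'
        PalmUnimodularRigidity.LayeredLawsSelectHcp.hcpQ rfl).2.2).symm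
    rw [e1, hestar]
    exact hmod a' h' ha'0.ne' hh'0.ne' ha' ha'1 hh'1 hh'2
  -- (1) registry majorisation, summed over the column
  have h1 : ∑ m ∈ Finset.Icc M₁ (M₁ + n), (inLayerInteraction lennardJones a' + Talt m) +
      c₀ * ∑ m ∈ Finset.Icc M₁ (M₁ + n), fault m ≤
      ∑ m ∈ Finset.Icc M₁ (M₁ + n), (inLayerInteraction lennardJones a' + Tact m) := by
    rw [Finset.mul_sum, ← Finset.sum_add_distrib]
    refine Finset.sum_le_sum fun m _ => ?_
    have h := (hW2 a' ha' ha'1 s hs H hH m).2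
    have hb : (0 : ℝ) ≤ (if s (m - 1) = s (m - 2) then (1 : ℝ) else 0) := by split_ifs <;> norm_num
    rw [hTact, hTalt, hfault]
    nlinarith [hc₀.le, hb]
  -- (2) free-block lower bound of the alternating column
  have h2 := hW3a a' ha' ha'1 H hH M₁ n
  simp only [← hΔ, ← hTalt] at h2
  -- faults, scale and spacing prices are bounded termwise by 1
  have hsp1 : ∀ m : ℤ, (H (m + 1) - H m - h) ^ 2 ≤ 1 := by
    intro m
    have := hH m
    have hlo : -1 ≤ H (m + 1) - H m - h := by linarith [this.1]
    have hhi : H (m + 1) - H m - h ≤ 1 := by linarith [this.2]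
    nlinarith
  have haa1 : (a' - a) ^ 2 ≤ 1 := by
    have hlo : -1 ≤ a' - a := by linarith
    have hhi : a' - a ≤ 1 := by linarith
    nlinarith
  have hf1 : ∀ m : ℤ, fault m ≤ 1 := fun m => by rw [hfault]; split_ifs <;> norm_num
  have hf0 : ∀ m : ℤ, 0 ≤ fault m := fun m => by rw [hfault]; split_ifs <;> norm_num
  have hCJ : CJ ≤ max CJ 0 := le_max_left _ _
  have hmax0 : 0 ≤ max CJ 0 := le_max_right _ _
  -- the statement's sums, rewritten
  have hcard : ((M₁ + n - M₁ + 1 : ℤ) : ℝ) = (n : ℝ) + 1 := by push_cast; ring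
  rw [hcard]
  have hprice : ∑ m ∈ Finset.Icc M₁ (M₁ + n), ((if s (m + 1) = s m then (1 : ℝ) else 0) +
      (a' - a) ^ 2 + (H (m + 1) - H m - h) ^ 2) =
      ∑ m ∈ Finset.Icc M₁ (M₁ + n), fault m + ((n : ℝ) + 1) * (a' - a) ^ 2 +
        ∑ m ∈ Finset.Icc M₁ (M₁ + n), (H (m + 1) - H m - h) ^ 2 := by
    rw [Finset.sum_add_distrib, Finset.sum_add_distrib, Finset.sum_const, Int.card_Icc,
      nsmul_eq_mul, show ((M₁ + n + 1 - M₁).toNat : ℝ) = (n : ℝ) + 1 by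
        rw [show (M₁ + n + 1 - M₁).toNat = n + 1 by omega]; push_cast; ring]
    simp only [hfault]
  rw [hprice]
  have hgoal : ∑ m ∈ Finset.Icc M₁ (M₁ + n), (inLayerInteraction lennardJones a' +
      ∑' k : ℤ, (if k = m then (0 : ℝ) else
        layerInteraction lennardJones a' (H k - H m) (haggLabel s k - haggLabel s m) 1)) =
      ∑ m ∈ Finset.Icc M₁ (M₁ + n), (inLayerInteraction lennardJones a' + Tact m) := by
    simp only [hTact]
  rw [← hestar, hgoal]
  -- the alternating column splits as `(n+1) Φ₀ + Σ Talt`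
  have hT : ∑ m ∈ Finset.Icc M₁ (M₁ + n), (inLayerInteraction lennardJones a' + Talt m) =
      ((n : ℝ) + 1) * inLayerInteraction lennardJones a' + ∑ m ∈ Finset.Icc M₁ (M₁ + n), Talt m := by
    rw [Finset.sum_add_distrib, Finset.sum_const, Int.card_Icc, nsmul_eq_mul,
      show ((M₁ + n + 1 - M₁).toNat : ℝ) = (n : ℝ) + 1 by
        rw [show (M₁ + n + 1 - M₁).toNat = n + 1 by omega]; push_cast; ring]
  rw [hT] at h1
  have hSf0 : 0 ≤ ∑ m ∈ Finset.Icc M₁ (M₁ + n), fault m := Finset.sum_nonneg fun m _ => hf0 m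
  rcases Nat.eq_zero_or_pos n with hn0 | hnpos
  · -- a single layer: everything is O(1)
    subst hn0
    simp only [Nat.cast_zero, zero_add, add_zero, Finset.Icc_self, Finset.sum_singleton, one_mul,
      Finset.range_zero, Finset.sum_empty, mul_zero] at h1 h2 ⊢
    have hsp := hsp1 M₁
    -- `Φ₀(a') ≥ 2 hcpE a' h₁ ≥ 2 e*` with `h₁` the first spacing
    have hb := hW3b a' ha' ha'1 (H (M₁ + 1) - H M₁) (hH M₁).1 (hH M₁).2 0
    simp only [Nat.cast_zero, zero_add, one_mul, Finset.range_zero, Finset.sum_empty, mul_zero] at hb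
    have hfl := hfloor (H (M₁ + 1) - H M₁) (hH M₁).1 (hH M₁).2
    have hcsq : 0 ≤ c * ((a' - a) ^ 2 + (H (M₁ + 1) - H M₁ - h) ^ 2) := by positivity
    have hfM := hf1 M₁
    have hfM0 := hf0 M₁
    have e1 : g * (fault M₁ + (a' - a) ^ 2 + (H (M₁ + 1) - H M₁ - h) ^ 2) ≤ g * 3 :=
      mul_le_mul_of_nonneg_left (by linarith) hg0.le
    nlinarith [hg0, hc₀, hfM0]
  · -- n ≥ 1: Jensen over shifts + uniform block + modulus at the mean spacing
    have hn1 : 1 ≤ n := hnpos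
    obtain ⟨μ, hμ⟩ : ∃ μ : ℝ, μ = (∑ i' ∈ Finset.range n, Δ i') / n := ⟨_, rfl⟩
    obtain ⟨hμ1, hμ2⟩ := mean_mem hn1 hΔband
    rw [← hμ] at hμ1 hμ2
    have h3 := hW1 a' ha' ha'1 n hn1 Δ hΔband
    rw [← hμ] at h3
    have h4 := hW3b a' ha' ha'1 μ hμ1 hμ2 n
    have hfl := hfloor μ hμ1 hμ2
    -- the spacing prices over the column: the `n` block increments plus the last bond
    have hsp : ∑ m ∈ Finset.Icc M₁ (M₁ + n), (H (m + 1) - H m - h) ^ 2 =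
        ∑ l ∈ Finset.range n, (Δ l - h) ^ 2 + (H (M₁ + n + 1) - H (M₁ + n) - h) ^ 2 := by
      rw [FreeBlockBounds.sum_Icc_eq_sum_range, Finset.sum_range_succ]
      simp only [hΔ]
    have hdev := sum_sq_sub_eq hn1 Δ h
    rw [← hμ] at hdev
    have hlast := hsp1 (M₁ + n)
    have hdev0 : 0 ≤ ∑ i ∈ Finset.range n, (Δ i - μ) ^ 2 := Finset.sum_nonneg fun i _ => sq_nonneg _
    have hn0 : (0 : ℝ) ≤ n := Nat.cast_nonneg n
    have hμh : 0 ≤ (μ - h) ^ 2 := sq_nonneg _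
    have haa : 0 ≤ (a' - a) ^ 2 := sq_nonneg _
    rw [hsp, hdev]
    -- the modulus floor, multiplied by the number of layers
    have hflX : 2 * ((n : ℝ) + 1) * (estar + c * ((a' - a) ^ 2 + (μ - h) ^ 2)) ≤
        2 * ((n : ℝ) + 1) * PalmUnimodularRigidity.LayeredLawsSelectHcp.hcpE a' μ :=
      mul_le_mul_of_nonneg_left hfl (by positivity)
    -- the prices against the gains
    have e5 : g * ∑ m ∈ Finset.Icc M₁ (M₁ + ↑n), fault m ≤ c₀ * ∑ m ∈ Finset.Icc M₁ (M₁ + ↑n), fault m :=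
      mul_le_mul_of_nonneg_right hgc₀ hSf0
    have e6 : g * (((n : ℝ) + 1) * (a' - a) ^ 2) ≤ 2 * c * (((n : ℝ) + 1) * (a' - a) ^ 2) :=
      mul_le_mul_of_nonneg_right hgc (by positivity)
    have e7 : g * ∑ i ∈ Finset.range n, (Δ i - μ) ^ 2 ≤ 2 * κ * ∑ i ∈ Finset.range n, (Δ i - μ) ^ 2 :=
      mul_le_mul_of_nonneg_right hgκ hdev0
    have e8a : (n : ℝ) * (μ - h) ^ 2 ≤ ((n : ℝ) + 1) * (μ - h) ^ 2 := by linarith [hμh]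
    have e8 : g * ((n : ℝ) * (μ - h) ^ 2) ≤ 2 * c * (((n : ℝ) + 1) * (μ - h) ^ 2) :=
      calc g * ((n : ℝ) * (μ - h) ^ 2) ≤ g * (((n : ℝ) + 1) * (μ - h) ^ 2) :=
            mul_le_mul_of_nonneg_left e8a hg0.le
        _ ≤ 2 * c * (((n : ℝ) + 1) * (μ - h) ^ 2) := mul_le_mul_of_nonneg_right hgc (by positivity)
    have e9 : g * (H (M₁ + n + 1) - H (M₁ + n) - h) ^ 2 ≤ g * 1 :=
      mul_le_mul_of_nonneg_left hlast hg0.le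
    linarith [h1, h2, h3, h4, hflX, e5, e6, e7, e8, e9, hmax0, hCJ, hg0.le]

end Summit.AtomisticToContinuum.Crystallization.Theorems.HcpLandscapeGapBirth

end
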